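import Summits.QuantumFields.BalabanUV.Beta.GAN24.T2ShapeEvenEnd
import Summits.QuantumFields.BalabanUV.Beta.GAN24.CombAffineUnrollProjected

/-!
# `BalabanUV.Beta.GAN24.CombT2ShapeEvenEnd` — binder row G-an2-4 ∕ (CONV-C), TRANSFER-III: **LINK L8c OF THE (α-0) CHAIN AT ROW D1's LITERAL OF RECORD (III′) —
# THE «T2Shape^ε» SOCKET FOR THE COMB-CHART `T₂` TOWER: the `ε`-member `y_n = ½ • (T̃′_n + ε • P T̃′_n)` of the comb-chart unit tower
# `T̃′_j = unitS₂_j (T2RecOf 3 Lc (GcombSh Lc) (SpureCombOf tabs …) tabs.M cE₂ cB Tc tabs.vh₂S tabs.mixFF j)` is UNIFORMLY `LocStencil₂` ⟸ the two displayed rows of its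
# RELATIVE source `b′^{rel,ε}_l = ½ • (b̃′_l + ε • P b̃′_l) + (𝒜^{G′}_l y_l − 𝒜^K_l y_l)` (uniformly `LocStencil₂`: `hb`; jointly `Lc`-covariant ∧ `ZfreeSym`: `hZ`)** — MY (E) socket
# `T2ShapeEvenEnd.locStencil₂_halfMember_three_of_relSource_rows` (there: (E) = `T2RecAt ρ`, `Ĝ_j = coDressKBmAt ρ Lc (KInvStep Lc j)`) RE-RUN at the sym ∕ comb slot data:
# road-P2's HYB-END `T2HybridShapeEnd.shape_three_of_hyb_rows` UNCHANGED (its transport is road W3's UNDRESSED `KInvStep`, its K-slot MY `KSlotAssembly.convCKWall_holds` —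
# both chart-free), `hsplit` := MY `CombAffineUnrollProjected.unitS₂_T2RecOf_comb_half_eq_transportB_add_sum_cell` (L8a at (III′), hypothesis-free), member 0 := §1
# (slot-free apart from the border), `CT := 0`
# (OWNER of row G-an2-4, unit `b2b-balaban-gan24-p1` gen 46; no existing file touched)

NOT IN PRINT; OUR BOOKKEEPING ([folklore] composition BY NAME; the statement is the (E) socket's with `(coDressKBmAt ρ (KInvStep j), SpureRecAt ρ, M1At ρ cΛ, vh₂S, mixFFAt ρ)
↦ (GcombSh Lc j, SpureCombOf tabs, tabs.M, tabs.vh₂S, tabs.mixFF)` and the root binder `hr` replaced by the record `tabs`; 0 `def`, 0 cited fact, 0 `def … : Prop`, 0 sorry).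
HONEST FRAMING (cell contract, verbatim): «discharging `BetaPertH` makes Bałaban's UV stability UNCONDITIONAL — a real constructive-QFT result; it is NOT the continuum limit
and NOT the Clay problem.»  HONEST DEPENDENCY (verbatim): «continuum YM on T⁴ ⇐ BetaPertH ∧ nine spine estimates (0/9 proved); BetaPertH ⇐ (D1) ∧ (D4) ∧ CAP+tail;
G-an2-4 gates asym, D1 and NE2/3/4.»

WHY (OWNER link table R-gan24p1-g46-2, row «L8b–L9 … INSTANCE-stated … THE BULK of the W-campaign: twins over `T2RecOf … (GcombSh Lc) (SpureCombOf tabs …) tabs.M …`;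
first refusal = the (E) authors» — L8c's (E) author is the OWNER).  This is the FIRST of those twins and shows their price: the engine (`shape_three_of_hyb_rows`) is
chart-free, the `hsplit` is L8a at (III′), member 0 is slot-free; what stays DISPLAYED — `hb`, `hZ` on the relative source — is where the (III′) campaign's content lives
(at (E): L8d ∕ L12 ∕ L13's letter chains; at (III′): the cells carry the two co-dressings AND an1's symmetrised corrector, `GcombSh = Ψ̂_S ∘ coDressKBmAt ρ_c (KInvStep) ∘ Ψ̂_Sᵀ`).

CONTENT (`d + 1 = 4` for §2; §1 generic `d`).
* §1 `locStencil₂_unitS₂_T2RecOf_comb_zero` — member 0 of the comb-chart unit tower is `LocStencil₂` at any rate below the border's (road-P2's `locStencil₂_unitS₂_T2RecAt_zero`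
  verbatim: member 0 = `cE₂ • wilsonW₂ + cB • tabs.vh₂S`, slot-free).
* §2 **`locStencil₂_halfMember_comb_three_of_relSource_rows`** — THE SOCKET (`2 ≤ Lc`, `|cE₂| ≤ Lc^8`, `|ε| ≤ 1`, any sym record `tabs` with off-diagonal `LocStencil₂` border
  `tabs.vh₂S` at `(CB, δB)`, any `cE cVH cΛ cB Tc`): `hb` ∧ `hZ` ⟹ `∃ C₂ δ₂ > 0, ∀ n, LocStencil₂ (y_n) C₂ δ₂`.
WHAT THIS IS NOT.  No source row is proved (`hb`, `hZ` displayed); not «T2Drift^ε» (L8c′), not `hcell` (L8b′), not the capstone L9, not one W-slot row unconditionally;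
NEVER «G-an2-4 closed» as (CONV-C); NOT D1, NOT `BetaPertH`, NOT continuum, NOT Clay.  2026-08-25.
-/

noncomputable section

open Finset
open scoped BigOperators
open Literature.MathematicalPhysics.QuantumFieldTheory
open Literature.MathematicalPhysics.QuantumFieldTheory.Balaban1983to89
open Literature.MathematicalPhysics.QuantumFieldTheory.Balaban1983to89.Beta
open ExpKernelCalculus (MKer shiftK)
open OneStepResolventKernel (Fib LocStencil)
open OneStepKernelFamily (KInvStep)
open SecondOrderResponse (W2SymOfK)
open BalabanCompositeJets (LocStencil₂ LocStencil₂.mono)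
open BalabanStepJetsSucc (mmRead)
open BalabanStepW2 (K3OfK M2Of locStencil₂_smul' locStencil₂_add')
open WilsonBiStencil (wilsonW₂ wBound₂ biLoc_wilsonW₂)
open Summit.QuantumFields.BalabanUV.Beta.TameKernelCalculus (trK)
open Summit.QuantumFields.BalabanUV.Beta.BorderedHessian (sgnK)
open Summit.QuantumFields.BalabanUV.Beta.HessKerDressedUnits (unitK unitS)
open Summit.QuantumFields.BalabanUV.Beta.SecondOrderUnits (unitM unitS₂ unitM₂)
open Summit.QuantumFields.BalabanUV.Beta.SpineRooted (T2RecOf T2RecOf_zero_level)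
open Summit.QuantumFields.BalabanUV.Beta.SymmetrisedStepJets (SymTables)
open Summit.QuantumFields.BalabanUV.Beta.CombChartStepJets (GcombSh SpureCombOf)
open Summit.QuantumFields.BalabanUV.Beta.GAN24.CombesThomas (sfStep smStep)
open Summit.QuantumFields.BalabanUV.Beta.GAN24.Push4Iter (BiTab)
open Summit.QuantumFields.BalabanUV.Beta.GAN24.T2RecursionAffine (lin4)
open Summit.QuantumFields.BalabanUV.Beta.GAN24.AffineUnroll (transport)
open Summit.QuantumFields.BalabanUV.Beta.GAN24.BiStencilZeroMode (zmode)
open Summit.QuantumFields.BalabanUV.Beta.GAN24.T2SlotUnits (unitS₂_step_zero)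
open Summit.QuantumFields.BalabanUV.Beta.GAN24.KSlotAssembly (convCKWall_holds)
open Summit.QuantumFields.BalabanUV.Beta.GAN24.WSlotT2OfPieces (locStencil₂_zero)
open Summit.QuantumFields.BalabanUV.Beta.GAN24.T2HybridShapeEnd (shape_three_of_hyb_rows)
open Summit.QuantumFields.BalabanUV.Beta.GAN24.T2ShapeEvenEnd (locStencil₂_halfTable)
open Summit.QuantumFields.BalabanUV.Beta.GAN24.CombAffineUnrollProjected (unitS₂_T2RecOf_comb_half_eq_transportB_add_sum_cell)

namespace Summit.QuantumFields.BalabanUV.Beta.GAN24.CombT2ShapeEvenEnd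

/-! ## §1 Member 0 of the comb-chart unit tower (generic `d`; slot-free apart from the border) -/

section Zero

variable {d : ℕ} {Lc : ℕ} [NeZero Lc]

/-- [folklore] **MEMBER 0 OF THE COMB-CHART UNIT `T₂` TOWER IS `LocStencil₂`** at any rate `0 ≤ δ ≤ δB` below the border's: member 0 = `cE₂ • wilsonW₂ d Tc + cB • tabs.vh₂S`
(`T2RecOf_zero_level`, units `1` at level 0 by `unitS₂_step_zero`), the Wilson bi-stencil localised at every rate (`biLoc_wilsonW₂`) — road-P2's
`T2HybridShapeEnd.locStencil₂_unitS₂_T2RecAt_zero` with the record's border. -/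
theorem locStencil₂_unitS₂_T2RecOf_comb_zero (tabs : SymTables d Lc) (cE cVH cΛ cE₂ cB : ℝ) (Tc : Fin 4 → Fin 4 → Fin 4 → Fin 4 → ℝ)
    {CB δB δ : ℝ} (hB : LocStencil₂ tabs.vh₂S CB δB) (hδ : 0 ≤ δ) (hδB : δ ≤ δB) :
    LocStencil₂ (unitS₂ (sfStep Lc 0) (smStep d Lc 0) (T2RecOf d Lc (GcombSh Lc) (SpureCombOf tabs cE cVH cΛ) tabs.M cE₂ cB Tc tabs.vh₂S tabs.mixFF 0))
      (|cE₂| * (wBound₂ d Tc * Real.exp (8 * δ)) + |cB| * CB) δ := by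
  rw [unitS₂_step_zero, T2RecOf_zero_level]
  have hWil : LocStencil₂ (wilsonW₂ d Tc) (wBound₂ d Tc * Real.exp (8 * δ)) δ := fun κ u κ' u' => biLoc_wilsonW₂ Tc hδ κ u κ' u'
  exact locStencil₂_add' (locStencil₂_smul' cE₂ hWil) (locStencil₂_smul' cB (hB.mono hδB))

end Zero

/-! ## §2 `d = 3`: the «T2Shape^ε» socket at the comb-chart slot data, relative-source rows displayed -/

section Three

variable {Lc : ℕ} [NeZero Lc]

/-- **LINK L8c AT (III′): THE «T2Shape^ε» SOCKET FOR THE COMB-CHART `T₂` TOWER** [our bookkeeping; folklore composition] (`d = 3`, `2 ≤ Lc`, any `tabs : SymTables 3 Lc`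
with off-diagonal border `tabs.vh₂S` (`hBff hBmm`) localised at `(CB, δB)`, `|cE₂| ≤ Lc^8`, `|ε| ≤ 1`, any `cE cVH cΛ cB Tc`): under the two rows of the RELATIVE source
`b′^{rel,ε}_l = ½ • (b̃′_l + ε • P b̃′_l) + (𝒜^{G′}_l y_l − 𝒜^K_l y_l)` — uniformly `LocStencil₂` (`hb`) and jointly `Lc`-covariant ∧ `ZfreeSym` (`hZ`) — the `ε`-member
`y_n = ½ • (T̃′_n + ε • P T̃′_n)` is UNIFORMLY `LocStencil₂`.  Proof = MY (E) socket's, token for token: road-P2's `shape_three_of_hyb_rows` at `T := y`, `b := b′^{rel,ε}`, `CT := 0`,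
K-slot `convCKWall_holds`, `hsplit` := `CombAffineUnrollProjected.unitS₂_T2RecOf_comb_half_eq_transportB_add_sum_cell`, member 0 := §1 ⨾ `T2ShapeEvenEnd.locStencil₂_halfTable`. -/
theorem locStencil₂_halfMember_comb_three_of_relSource_rows (hLc : 2 ≤ Lc) (tabs : SymTables 3 Lc) (cE cVH cΛ cE₂ cB : ℝ)
    (hpin : |cE₂| ≤ (Lc : ℝ) ^ (2 * (3 + 1))) (Tc : Fin 4 → Fin 4 → Fin 4 → Fin 4 → ℝ)
    (hBff : ∀ κ u κ' u' x z (α β : Fin (3 + 1)), tabs.vh₂S κ u κ' u' x z (Sum.inl α) (Sum.inl β) = 0)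
    (hBmm : ∀ κ u κ' u' x z (μ ν : Fin (3 + 1)), tabs.vh₂S κ u κ' u' x z (Sum.inr μ) (Sum.inr ν) = 0)
    {CB δB : ℝ} (hB : LocStencil₂ tabs.vh₂S CB δB) (hδB : 0 < δB)
    (ε : ℝ) (hε : |ε| ≤ 1) {Cb δb : ℝ}
    (hb : ∀ l, LocStencil₂
      (((1 : ℝ) / 2) • ((fun κ u κ' u' => (cE₂ * (Lc : ℝ) ^ (2 * (3 + 1))) • mmRead Lc (K3OfK (unitK (sfStep Lc l) (smStep 3 Lc l) (GcombSh (d := 3) Lc l)) Lc (unitS (sfStep Lc l) (smStep 3 Lc l) (SpureCombOf tabs cE cVH cΛ l)) (unitM (sfStep Lc l) (smStep 3 Lc l)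
            (tabs.M l)) (W2SymOfK (unitK (sfStep Lc l) (smStep 3 Lc l) (GcombSh (d := 3) Lc l)) Lc (unitS
            (sfStep Lc l) (smStep 3 Lc l) (SpureCombOf tabs cE cVH cΛ l)) (unitM (sfStep Lc l) (smStep 3 Lc l) (tabs.M l)) 0 (unitM₂
            (sfStep Lc l) (smStep 3 Lc l) (M2Of 3 Lc tabs.mixFF l))) κ u κ' u') + cB • tabs.vh₂S κ u κ' u') + ε • fun κ u κ' u' => sgnK (trK ((cE₂ *
            (Lc : ℝ) ^ (2 * (3 + 1))) • mmRead Lc (K3OfK (unitK (sfStep Lc l) (smStep 3 Lc l) (GcombSh (d := 3) Lc l)) Lc (unitS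
            (sfStep Lc l) (smStep 3 Lc l) (SpureCombOf tabs cE cVH cΛ l)) (unitM (sfStep Lc l) (smStep 3 Lc l) (tabs.M l)) (W2SymOfK
            (unitK (sfStep Lc l) (smStep 3 Lc l) (GcombSh (d := 3) Lc l)) Lc (unitS (sfStep Lc l) (smStep 3 Lc l) (SpureCombOf tabs cE cVH cΛ l)) (unitM (sfStep Lc l) (smStep 3 Lc l) (tabs.M l)) 0 (unitM₂ (sfStep Lc l) (smStep 3 Lc l) (M2Of 3 Lc tabs.mixFF l))) κ u κ' u') + cB • tabs.vh₂S κ u κ' u'))) +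
          (lin4 (cE₂ * (Lc : ℝ) ^ (2 * (3 + 1))) (unitK (sfStep Lc l) (smStep 3 Lc l) (GcombSh (d := 3) Lc l)) Lc (((1 : ℝ) / 2)
                • (unitS₂ (sfStep Lc l) (smStep 3 Lc l) (T2RecOf 3 Lc (GcombSh Lc) (SpureCombOf tabs cE cVH cΛ) tabs.M cE₂ cB Tc tabs.vh₂S tabs.mixFF l) + ε • fun κ u κ' u' =>
                sgnK (trK ((unitS₂ (sfStep Lc l) (smStep 3 Lc l) (T2RecOf 3 Lc (GcombSh Lc) (SpureCombOf tabs cE cVH cΛ) tabs.M cE₂ cB Tc tabs.vh₂S tabs.mixFF l)) κ u κ' u')))) -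
            lin4 (cE₂ * (Lc : ℝ) ^ (2 * (3 + 1))) (unitK (sfStep Lc l) (smStep 3 Lc l) (KInvStep (d := 3) Lc l)) Lc (((1 : ℝ) / 2) • (unitS₂ (sfStep Lc l)
                  (smStep 3 Lc l) (T2RecOf 3 Lc (GcombSh Lc) (SpureCombOf tabs cE cVH cΛ) tabs.M cE₂ cB Tc tabs.vh₂S tabs.mixFF l) + ε • fun κ u κ' u' => sgnK (trK ((unitS₂
                  (sfStep Lc l) (smStep 3 Lc l) (T2RecOf 3 Lc (GcombSh Lc) (SpureCombOf tabs cE cVH cΛ) tabs.M cE₂ cB Tc tabs.vh₂S tabs.mixFF l)) κ u κ' u')))))) Cb δb)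
    (hδb : 0 < δb)
    (hZ : ∀ l,
      (∀ (κ : Fin (3 + 1)) (u : Fin (3 + 1) → ℤ) (κ' : Fin (3 + 1)) (u' t : Fin (3 + 1) → ℤ),
        (((1 : ℝ) / 2) • ((fun κ u κ' u' => (cE₂ * (Lc : ℝ) ^ (2 * (3 + 1))) • mmRead Lc (K3OfK (unitK (sfStep Lc l) (smStep 3 Lc l) (GcombSh (d := 3) Lc l)) Lc (unitS (sfStep Lc l) (smStep 3 Lc l) (SpureCombOf tabs cE cVH cΛ l)) (unitM (sfStep Lc l) (smStep 3 Lc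
              l) (tabs.M l)) (W2SymOfK (unitK (sfStep Lc l) (smStep 3 Lc l) (GcombSh (d := 3) Lc l)) Lc (unitS
              (sfStep Lc l) (smStep 3 Lc l) (SpureCombOf tabs cE cVH cΛ l)) (unitM (sfStep Lc l) (smStep 3 Lc l) (tabs.M l)) 0
              (unitM₂ (sfStep Lc l) (smStep 3 Lc l) (M2Of 3 Lc tabs.mixFF l))) κ u κ' u') + cB • tabs.vh₂S κ u κ' u') + ε • fun κ u κ' u' => sgnK (trK
              ((cE₂ * (Lc : ℝ) ^ (2 * (3 + 1))) • mmRead Lc (K3OfK (unitK (sfStep Lc l) (smStep 3 Lc l) (GcombSh (d := 3) Lc l))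
              Lc (unitS (sfStep Lc l) (smStep 3 Lc l) (SpureCombOf tabs cE cVH cΛ l)) (unitM (sfStep Lc l) (smStep 3 Lc l) (tabs.M l)) (W2SymOfK (unitK (sfStep Lc l) (smStep 3 Lc l) (GcombSh (d := 3) Lc l)) Lc (unitS (sfStep Lc l) (smStep 3 Lc l)
              (SpureCombOf tabs cE cVH cΛ l)) (unitM (sfStep Lc l) (smStep 3 Lc l) (tabs.M l)) 0 (unitM₂ (sfStep Lc l) (smStep 3 Lc
              l) (M2Of 3 Lc tabs.mixFF l))) κ u κ' u') + cB • tabs.vh₂S κ u κ' u'))) +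
          (lin4 (cE₂ * (Lc : ℝ) ^ (2 * (3 + 1))) (unitK (sfStep Lc l) (smStep 3 Lc l) (GcombSh (d := 3) Lc l)) Lc (((1 : ℝ) / 2)
                • (unitS₂ (sfStep Lc l) (smStep 3 Lc l) (T2RecOf 3 Lc (GcombSh Lc) (SpureCombOf tabs cE cVH cΛ) tabs.M cE₂ cB Tc tabs.vh₂S tabs.mixFF l) + ε • fun κ u κ' u' =>
                sgnK (trK ((unitS₂ (sfStep Lc l) (smStep 3 Lc l) (T2RecOf 3 Lc (GcombSh Lc) (SpureCombOf tabs cE cVH cΛ) tabs.M cE₂ cB Tc tabs.vh₂S tabs.mixFF l)) κ u κ' u')))) -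
            lin4 (cE₂ * (Lc : ℝ) ^ (2 * (3 + 1))) (unitK (sfStep Lc l) (smStep 3 Lc l) (KInvStep (d := 3) Lc l)) Lc (((1 : ℝ) / 2) • (unitS₂ (sfStep Lc l)
                  (smStep 3 Lc l) (T2RecOf 3 Lc (GcombSh Lc) (SpureCombOf tabs cE cVH cΛ) tabs.M cE₂ cB Tc tabs.vh₂S tabs.mixFF l) + ε • fun κ u κ' u' => sgnK (trK ((unitS₂
                  (sfStep Lc l) (smStep 3 Lc l) (T2RecOf 3 Lc (GcombSh Lc) (SpureCombOf tabs cE cVH cΛ) tabs.M cE₂ cB Tc tabs.vh₂S tabs.mixFF l)) κ u κ' u')))))) κ (u + (Lc : ℤ) •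
                  t) κ' (u' + (Lc : ℤ) • t) = shiftK (-((Lc : ℤ) • t)) ((((1 : ℝ) / 2) • ((fun κ u κ' u' => (cE₂ * (Lc : ℝ) ^ (2 * (3 + 1))) • mmRead Lc (K3OfK
                  (unitK (sfStep Lc l) (smStep 3 Lc l) (GcombSh (d := 3) Lc l)) Lc (unitS (sfStep Lc l) (smStep 3 Lc l)
                  (SpureCombOf tabs cE cVH cΛ l)) (unitM (sfStep Lc l) (smStep 3 Lc l) (tabs.M l)) (W2SymOfK (unitK (sfStep Lc l)
                  (smStep 3 Lc l) (GcombSh (d := 3) Lc l)) Lc (unitS (sfStep Lc l) (smStep 3 Lc l) (SpureCombOf tabs cE cVH cΛ l)) (unitM (sfStep Lc l) (smStep 3 Lc l) (tabs.M l)) 0 (unitM₂ (sfStep Lc l) (smStep 3 Lc l) (M2Of 3 Lc tabs.mixFF l))) κ u κ' u') + cB • tabs.vh₂S κ u κ' u') + ε • fun κ u κ' u' => sgnK (trK ((cE₂ * (Lc : ℝ) ^ (2 * (3 + 1))) • mmRead Lc (K3OfK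
                  (unitK (sfStep Lc l) (smStep 3 Lc l) (GcombSh (d := 3) Lc l)) Lc (unitS (sfStep Lc l) (smStep 3 Lc l)
                  (SpureCombOf tabs cE cVH cΛ l)) (unitM (sfStep Lc l) (smStep 3 Lc l) (tabs.M l)) (W2SymOfK (unitK (sfStep Lc l)
                  (smStep 3 Lc l) (GcombSh (d := 3) Lc l)) Lc (unitS (sfStep Lc l) (smStep 3 Lc l) (SpureCombOf tabs cE cVH cΛ l)) (unitM (sfStep Lc l) (smStep 3 Lc l) (tabs.M l)) 0 (unitM₂ (sfStep Lc l) (smStep 3 Lc l) (M2Of 3 Lc tabs.mixFF l))) κ u κ' u') + cB • tabs.vh₂S κ u κ' u'))) +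
          (lin4 (cE₂ * (Lc : ℝ) ^ (2 * (3 + 1))) (unitK (sfStep Lc l) (smStep 3 Lc l) (GcombSh (d := 3) Lc l)) Lc (((1 : ℝ) / 2)
                • (unitS₂ (sfStep Lc l) (smStep 3 Lc l) (T2RecOf 3 Lc (GcombSh Lc) (SpureCombOf tabs cE cVH cΛ) tabs.M cE₂ cB Tc tabs.vh₂S tabs.mixFF l) + ε • fun κ u κ' u' =>
                sgnK (trK ((unitS₂ (sfStep Lc l) (smStep 3 Lc l) (T2RecOf 3 Lc (GcombSh Lc) (SpureCombOf tabs cE cVH cΛ) tabs.M cE₂ cB Tc tabs.vh₂S tabs.mixFF l)) κ u κ' u')))) -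
            lin4 (cE₂ * (Lc : ℝ) ^ (2 * (3 + 1))) (unitK (sfStep Lc l) (smStep 3 Lc l) (KInvStep (d := 3) Lc l)) Lc (((1 : ℝ) / 2) • (unitS₂ (sfStep Lc l)
                  (smStep 3 Lc l) (T2RecOf 3 Lc (GcombSh Lc) (SpureCombOf tabs cE cVH cΛ) tabs.M cE₂ cB Tc tabs.vh₂S tabs.mixFF l) + ε • fun κ u κ' u' => sgnK (trK ((unitS₂
                  (sfStep Lc l) (smStep 3 Lc l) (T2RecOf 3 Lc (GcombSh Lc) (SpureCombOf tabs cE cVH cΛ) tabs.M cE₂ cB Tc tabs.vh₂S tabs.mixFF l)) κ u κ' u')))))) κ u κ' u')) ∧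
      (∀ κ κ' κ₁ κ₂, zmode Lc (((1 : ℝ) / 2) • ((fun κ u κ' u' => (cE₂ * (Lc : ℝ) ^ (2 * (3 + 1))) • mmRead Lc (K3OfK (unitK (sfStep Lc l) (smStep 3 Lc l)
            (GcombSh (d := 3) Lc l)) Lc (unitS (sfStep Lc l) (smStep 3 Lc l) (SpureCombOf tabs cE cVH cΛ l)) (unitM
            (sfStep Lc l) (smStep 3 Lc l) (tabs.M l)) (W2SymOfK (unitK (sfStep Lc l) (smStep 3 Lc l) (GcombSh (d := 3) Lc l)) Lc (unitS (sfStep Lc l) (smStep 3 Lc l) (SpureCombOf tabs cE cVH cΛ l)) (unitM (sfStep Lc l) (smStep 3 Lc l) (tabs.M l)) 0 (unitM₂ (sfStep Lc l) (smStep 3 Lc l) (M2Of 3 Lc tabs.mixFF l))) κ u κ' u') + cB • tabs.vh₂S κ u κ' u') + ε • fun κ u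
            κ' u' => sgnK (trK ((cE₂ * (Lc : ℝ) ^ (2 * (3 + 1))) • mmRead Lc (K3OfK (unitK (sfStep Lc l) (smStep 3 Lc l) (GcombSh (d := 3) Lc l)) Lc (unitS (sfStep Lc l) (smStep 3 Lc l) (SpureCombOf tabs cE cVH cΛ l)) (unitM (sfStep Lc l) (smStep 3 Lc l) (tabs.M l)) (W2SymOfK (unitK (sfStep Lc l) (smStep 3 Lc l) (GcombSh (d := 3) Lc l)) Lc (unitS (sfStep Lc l)
            (smStep 3 Lc l) (SpureCombOf tabs cE cVH cΛ l)) (unitM (sfStep Lc l) (smStep 3 Lc l) (tabs.M l)) 0 (unitM₂ (sfStep Lc l)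
            (smStep 3 Lc l) (M2Of 3 Lc tabs.mixFF l))) κ u κ' u') + cB • tabs.vh₂S κ u κ' u'))) +
          (lin4 (cE₂ * (Lc : ℝ) ^ (2 * (3 + 1))) (unitK (sfStep Lc l) (smStep 3 Lc l) (GcombSh (d := 3) Lc l)) Lc (((1 : ℝ) / 2)
                • (unitS₂ (sfStep Lc l) (smStep 3 Lc l) (T2RecOf 3 Lc (GcombSh Lc) (SpureCombOf tabs cE cVH cΛ) tabs.M cE₂ cB Tc tabs.vh₂S tabs.mixFF l) + ε • fun κ u κ' u' =>
                sgnK (trK ((unitS₂ (sfStep Lc l) (smStep 3 Lc l) (T2RecOf 3 Lc (GcombSh Lc) (SpureCombOf tabs cE cVH cΛ) tabs.M cE₂ cB Tc tabs.vh₂S tabs.mixFF l)) κ u κ' u')))) -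
            lin4 (cE₂ * (Lc : ℝ) ^ (2 * (3 + 1))) (unitK (sfStep Lc l) (smStep 3 Lc l) (KInvStep (d := 3) Lc l)) Lc (((1 : ℝ) / 2) • (unitS₂ (sfStep Lc l)
                  (smStep 3 Lc l) (T2RecOf 3 Lc (GcombSh Lc) (SpureCombOf tabs cE cVH cΛ) tabs.M cE₂ cB Tc tabs.vh₂S tabs.mixFF l) + ε • fun κ u κ' u' => sgnK (trK ((unitS₂
                  (sfStep Lc l) (smStep 3 Lc l) (T2RecOf 3 Lc (GcombSh Lc) (SpureCombOf tabs cE cVH cΛ) tabs.M cE₂ cB Tc tabs.vh₂S tabs.mixFF l)) κ u κ' u')))))) κ κ' (Sum.inl κ₁)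
                  (Sum.inl κ₂) + zmode Lc (((1 : ℝ) / 2) • ((fun κ u κ' u' => (cE₂ * (Lc : ℝ) ^ (2 * (3 + 1))) • mmRead Lc (K3OfK (unitK (sfStep Lc l) (smStep
                  3 Lc l) (GcombSh (d := 3) Lc l)) Lc (unitS (sfStep Lc l) (smStep 3 Lc l) (SpureCombOf tabs cE cVH cΛ l)) (unitM (sfStep Lc l) (smStep 3 Lc l) (tabs.M l)) (W2SymOfK (unitK (sfStep Lc l) (smStep 3 Lc l) (GcombSh (d := 3) Lc l)) Lc (unitS (sfStep Lc l) (smStep 3 Lc l) (SpureCombOf tabs cE cVH cΛ l)) (unitM (sfStep Lc l) (smStep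
                  3 Lc l) (tabs.M l)) 0 (unitM₂ (sfStep Lc l) (smStep 3 Lc l) (M2Of 3 Lc tabs.mixFF l))) κ u κ' u') + cB • tabs.vh₂S κ u κ' u') + ε • fun κ u κ' u' => sgnK (trK ((cE₂ * (Lc : ℝ) ^ (2 * (3 + 1))) • mmRead Lc (K3OfK (unitK (sfStep Lc l) (smStep 3 Lc l)
                  (GcombSh (d := 3) Lc l)) Lc (unitS (sfStep Lc l) (smStep 3 Lc l) (SpureCombOf tabs cE cVH cΛ l))
                  (unitM (sfStep Lc l) (smStep 3 Lc l) (tabs.M l)) (W2SymOfK (unitK (sfStep Lc l) (smStep 3 Lc l) (GcombSh (d := 3) Lc l)) Lc (unitS (sfStep Lc l) (smStep 3 Lc l) (SpureCombOf tabs cE cVH cΛ l)) (unitM (sfStep Lc l) (smStep 3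
                  Lc l) (tabs.M l)) 0 (unitM₂ (sfStep Lc l) (smStep 3 Lc l) (M2Of 3 Lc tabs.mixFF l))) κ u κ' u') + cB • tabs.vh₂S κ u κ' u'))) +
          (lin4 (cE₂ * (Lc : ℝ) ^ (2 * (3 + 1))) (unitK (sfStep Lc l) (smStep 3 Lc l) (GcombSh (d := 3) Lc l)) Lc (((1 : ℝ) / 2)
                • (unitS₂ (sfStep Lc l) (smStep 3 Lc l) (T2RecOf 3 Lc (GcombSh Lc) (SpureCombOf tabs cE cVH cΛ) tabs.M cE₂ cB Tc tabs.vh₂S tabs.mixFF l) + ε • fun κ u κ' u' =>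
                sgnK (trK ((unitS₂ (sfStep Lc l) (smStep 3 Lc l) (T2RecOf 3 Lc (GcombSh Lc) (SpureCombOf tabs cE cVH cΛ) tabs.M cE₂ cB Tc tabs.vh₂S tabs.mixFF l)) κ u κ' u')))) -
            lin4 (cE₂ * (Lc : ℝ) ^ (2 * (3 + 1))) (unitK (sfStep Lc l) (smStep 3 Lc l) (KInvStep (d := 3) Lc l)) Lc (((1 : ℝ) / 2) • (unitS₂ (sfStep Lc l)
                  (smStep 3 Lc l) (T2RecOf 3 Lc (GcombSh Lc) (SpureCombOf tabs cE cVH cΛ) tabs.M cE₂ cB Tc tabs.vh₂S tabs.mixFF l) + ε • fun κ u κ' u' => sgnK (trK ((unitS₂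
                  (sfStep Lc l) (smStep 3 Lc l) (T2RecOf 3 Lc (GcombSh Lc) (SpureCombOf tabs cE cVH cΛ) tabs.M cE₂ cB Tc tabs.vh₂S tabs.mixFF l)) κ u κ' u')))))) κ' κ (Sum.inl κ₁)
                  (Sum.inl κ₂) = 0) ) :
    ∃ C₂ δ₂ : ℝ, 0 < δ₂ ∧ ∀ n, LocStencil₂ (((1 : ℝ) / 2) • (unitS₂ (sfStep Lc n) (smStep 3 Lc n) (T2RecOf 3 Lc (GcombSh Lc) (SpureCombOf tabs cE cVH cΛ) tabs.M cE₂ cB Tc tabs.vh₂S tabs.mixFF n) + ε • fun κ u κ' u' => sgnK (trK ((unitS₂ (sfStep Lc n) (smStep 3 Lc n) (T2RecOf 3 Lc (GcombSh Lc) (SpureCombOf tabs cE cVH cΛ) tabs.M cE₂ cB Tc tabs.vh₂S tabs.mixFF n)) κ u κ' u')))) C₂ δ₂ := by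
  obtain ⟨CK, δK, cK, θK, hδK, -, -, hK, -⟩ := convCKWall_holds (Lc := Lc) hLc
  -- member 0 at the border's rate, then its `ε`-half (§1)
  have h0 : LocStencil₂ (((1 : ℝ) / 2) • (unitS₂ (sfStep Lc 0) (smStep 3 Lc 0) (T2RecOf 3 Lc (GcombSh Lc) (SpureCombOf tabs cE cVH cΛ) tabs.M cE₂ cB Tc tabs.vh₂S tabs.mixFF 0) + ε
        • fun κ u κ' u' => sgnK (trK ((unitS₂ (sfStep Lc 0) (smStep 3 Lc 0) (T2RecOf 3 Lc (GcombSh Lc) (SpureCombOf tabs cE cVH cΛ) tabs.M cE₂ cB Tc tabs.vh₂S tabs.mixFF 0)) κ u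
        κ' u')))) (|cE₂| * (WilsonBiStencil.wBound₂ 3 Tc * Real.exp (8 * δB)) + |cB| * CB) δB :=
    locStencil₂_halfTable (locStencil₂_unitS₂_T2RecOf_comb_zero tabs cE cVH cΛ cE₂ cB Tc hB hδB.le le_rfl) hε
  -- leaf-01's even hsplit (HYPOTHESIS-FREE: the parity commutes with the dressed step, `Lin4ParityCovariance`), read as the socket's `hsplit` with `CT := 0`
  have hsplit := fun n => unitS₂_T2RecOf_comb_half_eq_transportB_add_sum_cell tabs cE cVH cΛ cE₂ cB Tc hBff hBmm ((1 : ℝ) / 2) ε n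
  have h := shape_three_of_hyb_rows hLc hK hδK cE₂ hpin
    (fun n => ((1 : ℝ) / 2) • (unitS₂ (sfStep Lc n) (smStep 3 Lc n) (T2RecOf 3 Lc (GcombSh Lc) (SpureCombOf tabs cE cVH cΛ) tabs.M cE₂ cB Tc tabs.vh₂S tabs.mixFF n) + ε • fun κ u
          κ' u' => sgnK (trK ((unitS₂ (sfStep Lc n) (smStep 3 Lc n) (T2RecOf 3 Lc (GcombSh Lc) (SpureCombOf tabs cE cVH cΛ) tabs.M cE₂ cB Tc tabs.vh₂S tabs.mixFF n)) κ u κ' u'))))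
    (fun l => (((1 : ℝ) / 2) • ((fun κ u κ' u' => (cE₂ * (Lc : ℝ) ^ (2 * (3 + 1))) • mmRead Lc (K3OfK (unitK (sfStep Lc l) (smStep 3 Lc l) (GcombSh (d := 3) Lc l)) Lc (unitS (sfStep Lc l) (smStep 3 Lc l) (SpureCombOf tabs cE cVH cΛ l)) (unitM (sfStep Lc l)
          (smStep 3 Lc l) (tabs.M l)) (W2SymOfK (unitK (sfStep Lc l) (smStep 3 Lc l) (GcombSh (d := 3) Lc l)) Lc
          (unitS (sfStep Lc l) (smStep 3 Lc l) (SpureCombOf tabs cE cVH cΛ l)) (unitM (sfStep Lc l) (smStep 3 Lc l) (tabs.M l)) 0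
          (unitM₂ (sfStep Lc l) (smStep 3 Lc l) (M2Of 3 Lc tabs.mixFF l))) κ u κ' u') + cB • tabs.vh₂S κ u κ' u') + ε • fun κ u κ' u' => sgnK (trK
          ((cE₂ * (Lc : ℝ) ^ (2 * (3 + 1))) • mmRead Lc (K3OfK (unitK (sfStep Lc l) (smStep 3 Lc l) (GcombSh (d := 3) Lc l)) Lc
          (unitS (sfStep Lc l) (smStep 3 Lc l) (SpureCombOf tabs cE cVH cΛ l)) (unitM (sfStep Lc l) (smStep 3 Lc l) (tabs.M l))
          (W2SymOfK (unitK (sfStep Lc l) (smStep 3 Lc l) (GcombSh (d := 3) Lc l)) Lc (unitS (sfStep Lc l) (smStep 3 Lc l)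
          (SpureCombOf tabs cE cVH cΛ l)) (unitM (sfStep Lc l) (smStep 3 Lc l) (tabs.M l)) 0 (unitM₂ (sfStep Lc l) (smStep 3 Lc l)
          (M2Of 3 Lc tabs.mixFF l))) κ u κ' u') + cB • tabs.vh₂S κ u κ' u'))) +
          (lin4 (cE₂ * (Lc : ℝ) ^ (2 * (3 + 1))) (unitK (sfStep Lc l) (smStep 3 Lc l) (GcombSh (d := 3) Lc l)) Lc (((1 : ℝ) / 2)
                • (unitS₂ (sfStep Lc l) (smStep 3 Lc l) (T2RecOf 3 Lc (GcombSh Lc) (SpureCombOf tabs cE cVH cΛ) tabs.M cE₂ cB Tc tabs.vh₂S tabs.mixFF l) + ε • fun κ u κ' u' =>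
                sgnK (trK ((unitS₂ (sfStep Lc l) (smStep 3 Lc l) (T2RecOf 3 Lc (GcombSh Lc) (SpureCombOf tabs cE cVH cΛ) tabs.M cE₂ cB Tc tabs.vh₂S tabs.mixFF l)) κ u κ' u')))) -
            lin4 (cE₂ * (Lc : ℝ) ^ (2 * (3 + 1))) (unitK (sfStep Lc l) (smStep 3 Lc l) (KInvStep (d := 3) Lc l)) Lc (((1 : ℝ) / 2) • (unitS₂ (sfStep Lc l)
                  (smStep 3 Lc l) (T2RecOf 3 Lc (GcombSh Lc) (SpureCombOf tabs cE cVH cΛ) tabs.M cE₂ cB Tc tabs.vh₂S tabs.mixFF l) + ε • fun κ u κ' u' => sgnK (trK ((unitS₂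
                  (sfStep Lc l) (smStep 3 Lc l) (T2RecOf 3 Lc (GcombSh Lc) (SpureCombOf tabs cE cVH cΛ) tabs.M cE₂ cB Tc tabs.vh₂S tabs.mixFF l)) κ u κ' u')))))))
    (fun _ => 0) (fun n => by simpa only [add_zero] using hsplit n) hb hδb hZ h0 hδB (fun _ => locStencil₂_zero (d := 3) δB) hδB
  simpa using h

end Three

end Summit.QuantumFields.BalabanUV.Beta.GAN24.CombT2ShapeEvenEnd

end
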